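import Summits.Ventures.PercRepro.RankLevelSetRuleQCellThreeBinom
import Summits.Ventures.PercRepro.RankLevelSetRuleQCellThreePoly
import Summits.Ventures.PercRepro.RankLevelSetRuleQCellEvalQ4A
import Summits.Ventures.PercRepro.RankLevelSetRuleQCellEvalQ5A
import Summits.Ventures.PercRepro.RankLevelSetRuleQCellEvalQ6A
import Summits.Ventures.PercRepro.RankLevelSetRuleQCellEvalQ7A
import Summits.Ventures.PercRepro.RankLevelSetRuleQCellEvalQ8A
import Summits.Ventures.PercRepro.RankLevelSetRuleQCellEvalQ9
import Summits.Ventures.PercRepro.RankLevelSetRuleQCellEvalQ10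

/-!
# PercRepro — THE TRUNCATED SLICE `u = 2` OF THE CELL `(q+4, q)`: (R̂) AT `m = q − 2` FOR EVERY `q ≥ 11`
(night-1, gen 16; dossier §27.5)

On the cell `(q+4, q)` the member slice `u = q − m = 2` is the first TRUNCATED one (`m̂(q, m; a, 3)` lacks the term
`C(q+a, a+3)`), and it is asymptotically tight: `R̂(q, 4, q−2)/Φ(q+4, q) → 1` (exact: 1.25, 1.21, 1.16, 1.12 at
`q = 16, 64, 128, 256`), with `S₁ → 1/2` and the margin of order `1/√q` — no geometric tail bound on the partial sum
`P = Σ_{i<m} C(q+m, i)` can close it. What closes it is that the row `n = q + m = 2m + 2` is SYMMETRIC about `m + 1`, so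
`P` is EXACT: `2P = 4^{m+1} − C(n, m) − C(n, m+1) − C(n, m+2)` (`sum_range_choose_half_two`). With `C = C(n, m)`,
`Y = 4^{m+1}`: `S₁ = ((m+1)C − P)/(C(2m+3))`, `S₂ = (C + 2P)/(2C(2m+3))` (`slice_two_S2_eq`), the `j = 3` term is dropped
(nonnegative), and `6S₁ + 15S₂ ≥ Φ(q+4, q)` is LINEAR in `Y/C` with positive coefficient; the Wallis lower bound
`C(2k, k)²·(3k+1) ≤ 16^k` (`centralBinom_sq_mul_le`, `k = m+1`) gives `Y/C ≥ (m+2)√(3m+4)/(m+1)` and the resulting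
polynomial inequality holds for every `m ≥ 9`. `Φ(q+4, q) = 2(q+4)/(q+1) + (q+4)(q+3)/((q+1)(q+2))` (`phiK_four'`).
* **`rhatCell_four_slice_two`** — `Φ(q+4, q) ≤ R̂(q, 4, q−2)` for every `q ≥ 11` (`q = m + 2`, `m ≥ 9`);
  **`rhat_four_slice_two_all`** — the same for EVERY `q ≥ 2` (`q ≤ 10` from gen 14's kernel cells `rhatCell_q_4`, `q ∈ {2, 3}`
  from `rhat_zero_eq` / `rhatCell_one`).
The untruncated regime `u ≥ 3` of the cell `k = 4` is the complementary item (p4's row method, or the one-inequality route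
of §27.4); with it, `RhatCell q 4` for every `q` would follow.
Twin: mining/night-1/g16/k4u2.py (the closed forms, exact `q < 40`), k4u2b.py (the linear-in-`x` finish with the Wallis
bound: holds for every `m ≥ 9`, squares ratio 1.10 at `m = 10` rising to 72.6 at `m = 1000`). Axioms: standard.
-/

namespace PercRepro

open Finset

/-! ### §1 The Wallis lower bound `C(2k, k)²·(3k+1) ≤ 16^k` -/

/-- **Wallis, lower bound**: `(centralBinom k)² · (3k + 1) ≤ 16^k` for `k ≥ 1` (equality at `k = 1`; induction with
`(k+1)·centralBinom (k+1) = 2(2k+1)·centralBinom k`, the step being `(2k+1)²(3k+4) ≤ 4(k+1)²(3k+1)`, i.e. `19k ≤ 20k`). -/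
lemma centralBinom_sq_mul_le : ∀ k : ℕ, 1 ≤ k → k.centralBinom ^ 2 * (3 * k + 1) ≤ 16 ^ k := by
  intro k
  induction k with
  | zero => intro h; omega
  | succ k ih =>
    intro _
    rcases Nat.eq_zero_or_pos k with hk0 | hkpos
    · subst hk0
      decide
    · have ih' := ih hkpos
      have hrec := Nat.succ_mul_centralBinom_succ k
      have h1 : (k + 1) ^ 2 * (3 * k + 1) * ((k + 1).centralBinom ^ 2 * (3 * (k + 1) + 1))
          = 4 * (2 * k + 1) ^ 2 * (3 * (k + 1) + 1) * (k.centralBinom ^ 2 * (3 * k + 1)) := by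
        have : ((k + 1) * (k + 1).centralBinom) ^ 2 = (2 * (2 * k + 1) * k.centralBinom) ^ 2 := by rw [hrec]
        nlinarith [this]
      have h2 : 4 * (2 * k + 1) ^ 2 * (3 * (k + 1) + 1) * (k.centralBinom ^ 2 * (3 * k + 1))
          ≤ 4 * (2 * k + 1) ^ 2 * (3 * (k + 1) + 1) * 16 ^ k :=
        Nat.mul_le_mul_left _ ih'
      have h3 : 4 * (2 * k + 1) ^ 2 * (3 * (k + 1) + 1) ≤ 16 * ((k + 1) ^ 2 * (3 * k + 1)) := by
        nlinarith
      have h4 : (k + 1) ^ 2 * (3 * k + 1) * ((k + 1).centralBinom ^ 2 * (3 * (k + 1) + 1))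
          ≤ (k + 1) ^ 2 * (3 * k + 1) * 16 ^ (k + 1) := by
        calc (k + 1) ^ 2 * (3 * k + 1) * ((k + 1).centralBinom ^ 2 * (3 * (k + 1) + 1))
            = 4 * (2 * k + 1) ^ 2 * (3 * (k + 1) + 1) * (k.centralBinom ^ 2 * (3 * k + 1)) := h1
          _ ≤ 4 * (2 * k + 1) ^ 2 * (3 * (k + 1) + 1) * 16 ^ k := h2
          _ ≤ 16 * ((k + 1) ^ 2 * (3 * k + 1)) * 16 ^ k := Nat.mul_le_mul_right _ h3
          _ = (k + 1) ^ 2 * (3 * k + 1) * 16 ^ (k + 1) := by ring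
      exact Nat.le_of_mul_le_mul_left h4 (by positivity)

/-! ### §2 The half-row identity on the symmetric row `2m + 2` -/

/-- **The half row**: `2·Σ_{i<m} C(2m+2, i) + C(2m+2, m) + C(2m+2, m+1) + C(2m+2, m+2) = 4^{m+1}` (the row sum `2^{2m+2}`,
the terms beyond `m+2` reflected onto the terms below `m`). -/
lemma sum_range_choose_half_two (m : ℕ) :
    2 * ∑ i ∈ range m, (2 * m + 2).choose i + (2 * m + 2).choose m + (2 * m + 2).choose (m + 1)
      + (2 * m + 2).choose (m + 2) = 4 ^ (m + 1) := by
  have hrow := Nat.sum_range_choose (2 * m + 2)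
  rw [show 2 * m + 2 + 1 = (m + 3) + m by ring, Finset.sum_range_add] at hrow
  have hrefl : ∑ i ∈ range m, (2 * m + 2).choose (m + 3 + i) = ∑ i ∈ range m, (2 * m + 2).choose i := by
    rw [← Finset.sum_range_reflect (fun i => (2 * m + 2).choose i) m]
    refine Finset.sum_congr rfl (fun i hi => ?_)
    rw [Finset.mem_range] at hi
    exact Nat.choose_symm_of_eq_add (by omega)
  rw [hrefl, Finset.sum_range_succ, Finset.sum_range_succ, Finset.sum_range_succ] at hrow
  rw [show (4 : ℕ) ^ (m + 1) = 2 ^ (2 * m + 2) by rw [show 2 * m + 2 = 2 * (m + 1) by ring, pow_mul]; norm_num]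
  omega

/-! ### §3 Ratios on the row `2m + 2` and the next row -/

/-- `C(2m+2, m+1)·(m+1) = C(2m+2, m)·(m+2)` and `C(2m+2, m+2) = C(2m+2, m)`. -/
lemma choose_row_two_ratios (m : ℕ) :
    (2 * m + 2).choose (m + 1) * (m + 1) = (2 * m + 2).choose m * (m + 2)
    ∧ (2 * m + 2).choose (m + 2) = (2 * m + 2).choose m := by
  constructor
  · have h := Nat.choose_succ_right_eq (2 * m + 2) m
    rw [show 2 * m + 2 - m = m + 2 by omega] at h
    exact h
  · exact Nat.choose_symm_of_eq_add (by omega)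

/-- `C(2m+2, m−1)·(m+3) = C(2m+2, m)·m` (for `m = s + 1`) and `C(2m+3, m)·(m+3) = C(2m+2, m)·(2m+3)`. -/
lemma choose_row_two_ratios' (s : ℕ) :
    (2 * (s + 1) + 2).choose s * (s + 4) = (2 * (s + 1) + 2).choose (s + 1) * (s + 1)
    ∧ (2 * (s + 1) + 3).choose (s + 1) * (s + 4) = (2 * (s + 1) + 2).choose (s + 1) * (2 * (s + 1) + 3) := by
  constructor
  · have h := Nat.choose_succ_right_eq (2 * (s + 1) + 2) s
    rw [show 2 * (s + 1) + 2 - s = s + 4 by omega] at h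
    linarith [h]
  · have h := Nat.choose_mul_succ_eq (2 * (s + 1) + 2) (s + 1)
    rw [show 2 * (s + 1) + 2 + 1 - (s + 1) = s + 4 by omega, show 2 * (s + 1) + 2 + 1 = 2 * (s + 1) + 3 by ring] at h
    linarith [h]

/-! ### §4 `Φ(q+4, q)` and the slice sums at `u = 2` -/

/-- `Φ(q+4, q) = 2(q+4)/(q+1) + (q+4)(q+3)/((q+1)(q+2))`. -/
lemma phiK_four' (q : ℕ) :
    phiK (q + 4) q = 2 * (q + 4 : ℚ) / (q + 1) + (q + 4 : ℚ) * (q + 3) / ((q + 1) * (q + 2)) := by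
  rw [phiK_eq_sum_range q 4 (by omega)]
  simp only [show (4 : ℕ) - 1 = 3 by rfl, Finset.sum_range_succ, Finset.sum_range_zero, zero_add,
    Nat.choose_one_right, add_zero]
  have h1 : (q + 0 + 1).choose q = q + 1 := by
    rw [show q + 0 + 1 = q + 1 by ring, Nat.choose_symm_add, Nat.choose_one_right]
  have h2 : (q + 1 + 1).choose q = (q + 2).choose 2 := by
    rw [show q + 1 + 1 = q + 2 by ring, Nat.choose_symm_add]
  have h3 : (q + 2 + 1).choose q = (q + 3).choose 3 := by
    rw [show q + 2 + 1 = q + 3 by ring, Nat.choose_symm_add]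
  obtain ⟨c2, c3, c4, -⟩ := choose_small_values q
  have e2 : ((q + 2).choose 2 : ℚ) = (q + 2) * (q + 1) / 2 := by rw [eq_div_iff (by norm_num)]; exact c2
  have e3 : ((q + 3).choose 3 : ℚ) = (q + 3) * (q + 2) * (q + 1) / 6 := by
    rw [eq_div_iff (by norm_num)]; rw [show q + 3 = q + 2 + 1 by ring]; exact c3
  have e4' : ((q + 4).choose 2 : ℚ) = (q + 4) * (q + 3) / 2 := by
    have h := Nat.add_one_mul_choose_eq (q + 3) 1
    rw [Nat.choose_one_right] at h
    rw [eq_div_iff (by norm_num)]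
    have h' : (((q + 3 + 1) * (q + 3) : ℕ) : ℚ) = (((q + 3 + 1).choose (1 + 1) * (1 + 1) : ℕ) : ℚ) := by rw [h]
    push_cast at h'
    rw [show (q : ℚ) + 4 = q + 3 + 1 by ring]
    linarith [h']
  have e4'' : ((q + 4).choose 3 : ℚ) = (q + 4) * (q + 3) * (q + 2) / 6 := by
    have h := Nat.add_one_mul_choose_eq (q + 3) 2
    rw [eq_div_iff (by norm_num)]
    have h' : (((q + 3 + 1) * (q + 3).choose 2 : ℕ) : ℚ) = (((q + 3 + 1).choose (2 + 1) * (2 + 1) : ℕ) : ℚ) := by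
      rw [h]
    push_cast at h'
    have h'' : ((q + 3).choose 2 : ℚ) = (q + 3) * (q + 2) / 2 := by
      obtain ⟨c2', -, -, -⟩ := choose_small_values (q + 1)
      rw [eq_div_iff (by norm_num)]
      rw [show q + 3 = q + 1 + 2 by ring]
      push_cast at c2' ⊢
      linarith [c2']
    rw [h''] at h'
    rw [show (q : ℚ) + 4 = q + 3 + 1 by ring]
    linarith [h']
  rw [h1, h2, h3]
  push_cast
  rw [e2, e3, e4', e4'']
  field_simp
  ring

/-! ### §5 The slice sum `S₂` at `u = 2` in closed form -/

/-- **`S₂` at `u = 2`** (`q = m + 2`, `n = 2m + 2`): `Σ_{a ≤ m} C(m, a)/C(q+2+a, a+2) = (C + 2P)/(2C(2m+3))` with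
`C = C(n, m)`, `P = Σ_{i<m} C(n, i)` — from `S₂ = S₁(q) − (q/(q+1))·S₁(q+1)` (the termwise identity), both in closed form
(`cellTwo_sum_eq` at `v = 1, 2`), and the row step `Σ_{i<m} C(n+1, i) = 2P − C(n, m−1)`. -/
lemma slice_two_S2_eq (m : ℕ) (hm : 1 ≤ m) :
    ∑ a ∈ range (m + 1), (m.choose a : ℚ) / ((m + 2 + 2 + a).choose (a + 2) : ℚ)
      = (((m + 1 + 1 + m).choose m : ℚ) + 2 * ∑ i ∈ range m, ((m + 1 + 1 + m).choose i : ℚ))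
        / (2 * ((m + 1 + 1 + m).choose m : ℚ) * (2 * m + 3)) := by
  have hsplit : ∑ a ∈ range (m + 1), (m.choose a : ℚ) / ((m + 2 + 2 + a).choose (a + 2) : ℚ)
      = ∑ a ∈ range (m + 1), (m.choose a : ℚ) / ((m + 1 + 1 + 1 + a).choose (a + 1) : ℚ)
        - ((m : ℚ) + 2) / ((m : ℚ) + 2 + 1)
          * ∑ a ∈ range (m + 1), (m.choose a : ℚ) / ((m + 2 + 1 + 1 + a).choose (a + 1) : ℚ) := by
    rw [Finset.mul_sum, ← Finset.sum_sub_distrib]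
    refine Finset.sum_congr rfl (fun a _ => ?_)
    have h := one_div_choose_succ_eq (m + 2) (a + 1)
    rw [show m + 2 + 1 + (a + 1) = m + 2 + 2 + a by ring, show m + 2 + (a + 1) = m + 1 + 1 + 1 + a by ring] at h
    push_cast at h
    have h' : (1 : ℚ) / ((m + 2 + 2 + a).choose (a + 2) : ℚ)
        = 1 / ((m + 1 + 1 + 1 + a).choose (a + 1) : ℚ)
          - ((m : ℚ) + 2) / ((m : ℚ) + 2 + 1) * (1 / ((m + 2 + 1 + 1 + a).choose (a + 1) : ℚ)) := by
      rw [show a + 2 = a + 1 + 1 by ring, show m + 2 + 1 + 1 + a = m + 2 + 2 + a by ring]; exact h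
    calc (m.choose a : ℚ) / ((m + 2 + 2 + a).choose (a + 2) : ℚ)
        = (m.choose a : ℚ) * (1 / ((m + 2 + 2 + a).choose (a + 2) : ℚ)) := by ring
      _ = (m.choose a : ℚ) * (1 / ((m + 1 + 1 + 1 + a).choose (a + 1) : ℚ)
          - ((m : ℚ) + 2) / ((m : ℚ) + 2 + 1) * (1 / ((m + 2 + 1 + 1 + a).choose (a + 1) : ℚ))) := by rw [h']
      _ = _ := by ring
  rw [hsplit, cellTwo_sum_eq m 1, cellTwo_sum_eq m 2]
  push_cast
  -- the next row: C' = C(2m+3, m), P' = Σ_{i<m} C(2m+3, i) = 2P − C(2m+2, m−1)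
  have hP' : ∑ i ∈ range m, ((m + 2 + 1 + m).choose i : ℚ)
      = 2 * ∑ i ∈ range m, ((m + 1 + 1 + m).choose i : ℚ) - ((m + 1 + 1 + m).choose (m - 1) : ℚ) := by
    have h := sum_choose_succ_eq (m + 1 + 1 + m) (m - 1)
    rw [show m - 1 + 1 = m by omega, show m + 1 + 1 + m + 1 = m + 2 + 1 + m by ring] at h
    have h2 : ∑ i ∈ range m, (m + 1 + 1 + m).choose i
        = ∑ i ∈ range (m - 1), (m + 1 + 1 + m).choose i + (m + 1 + 1 + m).choose (m - 1) := by
      rw [← Finset.sum_range_succ, show m - 1 + 1 = m by omega]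
    have h3 : ((∑ i ∈ range m, (m + 2 + 1 + m).choose i : ℕ) : ℚ)
        = ((∑ i ∈ range m, (m + 1 + 1 + m).choose i + ∑ i ∈ range (m - 1), (m + 1 + 1 + m).choose i : ℕ) : ℚ) := by
      rw [h]
    push_cast at h3
    rw [h3]
    have h4 : ((∑ i ∈ range (m - 1), (m + 1 + 1 + m).choose i : ℕ) : ℚ)
        = ((∑ i ∈ range m, (m + 1 + 1 + m).choose i : ℕ) : ℚ) - ((m + 1 + 1 + m).choose (m - 1) : ℚ) := by
      rw [h2]; push_cast; ring
    push_cast at h4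
    rw [h4]; ring
  rw [hP']
  set C := ((m + 1 + 1 + m).choose m : ℚ) with hC
  set P := ∑ i ∈ range m, ((m + 1 + 1 + m).choose i : ℚ) with hPdef
  set C' := ((m + 2 + 1 + m).choose m : ℚ) with hC'
  set Cm := ((m + 1 + 1 + m).choose (m - 1) : ℚ) with hCm
  have hCpos : (0 : ℚ) < C := by rw [hC]; exact_mod_cast Nat.choose_pos (by omega)
  have hC'pos : (0 : ℚ) < C' := by rw [hC']; exact_mod_cast Nat.choose_pos (by omega)
  -- C'·(m+3) = C·(2m+3) and Cm·(m+3) = C·m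
  have r1 : C' * ((m : ℚ) + 3) = C * (2 * m + 3) := by
    have h := Nat.choose_mul_succ_eq (m + 1 + 1 + m) m
    rw [show m + 1 + 1 + m + 1 - m = m + 3 by omega, show m + 1 + 1 + m + 1 = m + 2 + 1 + m by ring] at h
    have h' : C * ((m : ℚ) + 2 + 1 + m) = C' * (m + 3) := by
      rw [hC, hC']; exact_mod_cast h
    linarith [h']
  have r2 : Cm * ((m : ℚ) + 3) = C * m := by
    have h := Nat.choose_succ_right_eq (m + 1 + 1 + m) (m - 1)
    rw [show m - 1 + 1 = m by omega, show m + 1 + 1 + m - (m - 1) = m + 3 by omega] at h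
    have h' : C * (m : ℚ) = Cm * (m + 3) := by rw [hC, hCm]; exact_mod_cast h
    linarith [h']
  have eC' : C' = C * (2 * m + 3) / ((m : ℚ) + 3) := by rw [eq_div_iff (by positivity)]; exact r1
  have eCm : Cm = C * m / ((m : ℚ) + 3) := by rw [eq_div_iff (by positivity)]; exact r2
  rw [eC', eCm]
  field_simp
  ring

/-! ### §6 The two pure-ℚ steps of the finish -/

/-- The two slice terms `6S₁ + 15S₂` at `u = 2`, with `P = (WC − C(3m+4)/(m+1))/2`, are LINEAR in `W = 4^{m+1}/C`
with coefficient `9/2`. -/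
lemma sliceTwo_linear (m : ℕ) (C W : ℚ) (hC : 0 < C) :
    6 * ((((m : ℚ) + 1) * C - 1 * ((W * C - C * (3 * (m : ℚ) + 4) / ((m : ℚ) + 1)) / 2))
        / (C * ((m : ℚ) + 1 + 1 + (m : ℚ) + 1)))
        + 15 * ((C + 2 * ((W * C - C * (3 * (m : ℚ) + 4) / ((m : ℚ) + 1)) / 2)) / (2 * C * (2 * (m : ℚ) + 3)))
      = (6 * ((m : ℚ) + 1) + 15 / 2 - 9 / 2 * (3 * (m : ℚ) + 4) / ((m : ℚ) + 1) + 9 / 2 * W) / (2 * (m : ℚ) + 3) := by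
  field_simp
  ring

/-- **The finish** (`m = t + 9`, `W ≥ 0` with the Wallis bound `(3m+4)(m+2)² ≤ W²(m+1)²`):
`Φ(q+4, q) ≤ (6(m+1) + 15/2 − (9/2)(3m+4)/(m+1) + (9/2)W)/(2m+3)` — i.e. `R ≤ (9/2)W` for
`R = (2m+3)Φ − 6(m+1) − 15/2 + (9/2)(3m+4)/(m+1) = Rn/((m+1)(m+3)(m+4))`, by `Rn² ≤ (81/4)(m+2)²(3m+4)(m+3)²(m+4)²`
(the certificate `Q(t)` with nonnegative coefficients) and the Wallis bound. -/
lemma sliceTwo_finish (t : ℕ) (W : ℚ) (hWpos : 0 < W)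
    (hW2 : (3 * ((t : ℚ) + 9) + 4) * ((t : ℚ) + 9 + 2) ^ 2 ≤ W ^ 2 * ((t : ℚ) + 9 + 1) ^ 2) :
    2 * ((t : ℚ) + 9 + 2 + 4) / ((t : ℚ) + 9 + 2 + 1)
      + ((t : ℚ) + 9 + 2 + 4) * ((t : ℚ) + 9 + 2 + 3) / (((t : ℚ) + 9 + 2 + 1) * ((t : ℚ) + 9 + 2 + 2))
      ≤ (6 * ((t : ℚ) + 9 + 1) + 15 / 2 - 9 / 2 * (3 * ((t : ℚ) + 9) + 4) / ((t : ℚ) + 9 + 1) + 9 / 2 * W)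
        / (2 * ((t : ℚ) + 9) + 3) := by
  have hRn : (2 * ((t : ℚ) + 9) + 3) * (2 * ((t : ℚ) + 9 + 2 + 4) / ((t : ℚ) + 9 + 2 + 1)
        + ((t : ℚ) + 9 + 2 + 4) * ((t : ℚ) + 9 + 2 + 3) / (((t : ℚ) + 9 + 2 + 1) * ((t : ℚ) + 9 + 2 + 2)))
        - 6 * ((t : ℚ) + 9 + 1) - 15 / 2 + 9 / 2 * (3 * ((t : ℚ) + 9) + 4) / ((t : ℚ) + 9 + 1)
      = ((42462 : ℚ) + (22557/2 : ℚ) * (t : ℚ) + (1987/2 : ℚ) * (t : ℚ) ^ 2 + (29 : ℚ) * (t : ℚ) ^ 3) / (((t : ℚ) + 10) * ((t : ℚ) + 12) * ((t : ℚ) + 13)) := by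
    field_simp
    ring
  have hQ : (81 / 4 : ℚ) * ((t : ℚ) + 11) ^ 2 * (3 * ((t : ℚ) + 9) + 4) * ((t : ℚ) + 12) ^ 2 * ((t : ℚ) + 13) ^ 2
      - ((42462 : ℚ) + (22557/2 : ℚ) * (t : ℚ) + (1987/2 : ℚ) * (t : ℚ) ^ 2 + (29 : ℚ) * (t : ℚ) ^ 3) ^ 2 = (45486360 : ℚ) + (149635296 : ℚ) * (t : ℚ) + (144911187/2 : ℚ) * (t : ℚ) ^ 2 + (62209461/4 : ℚ) * (t : ℚ) ^ 3 + (7228709/4 : ℚ) * (t : ℚ) ^ 4 + (237347/2 : ℚ) * (t : ℚ) ^ 5 + (16643/4 : ℚ) * (t : ℚ) ^ 6 + (243/4 : ℚ) * (t : ℚ) ^ 7 := by ring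
  have hQnn : (0 : ℚ) ≤ (45486360 : ℚ) + (149635296 : ℚ) * (t : ℚ) + (144911187/2 : ℚ) * (t : ℚ) ^ 2 + (62209461/4 : ℚ) * (t : ℚ) ^ 3 + (7228709/4 : ℚ) * (t : ℚ) ^ 4 + (237347/2 : ℚ) * (t : ℚ) ^ 5 + (16643/4 : ℚ) * (t : ℚ) ^ 6 + (243/4 : ℚ) * (t : ℚ) ^ 7 := by positivity
  have hW2' : (3 * ((t : ℚ) + 9) + 4) * ((t : ℚ) + 11) ^ 2 ≤ W ^ 2 * ((t : ℚ) + 10) ^ 2 := by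
    have := hW2
    ring_nf at this ⊢
    linarith [this]
  have hRsq : (((42462 : ℚ) + (22557/2 : ℚ) * (t : ℚ) + (1987/2 : ℚ) * (t : ℚ) ^ 2 + (29 : ℚ) * (t : ℚ) ^ 3) / (((t : ℚ) + 10) * ((t : ℚ) + 12) * ((t : ℚ) + 13))) ^ 2 ≤ (9 / 2 * W) ^ 2 := by
    rw [div_pow, div_le_iff₀ (by positivity)]
    have h1 : ((42462 : ℚ) + (22557/2 : ℚ) * (t : ℚ) + (1987/2 : ℚ) * (t : ℚ) ^ 2 + (29 : ℚ) * (t : ℚ) ^ 3) ^ 2 ≤ (81 / 4 : ℚ) * ((t : ℚ) + 11) ^ 2 * (3 * ((t : ℚ) + 9) + 4) * ((t : ℚ) + 12) ^ 2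
        * ((t : ℚ) + 13) ^ 2 := by linarith [hQ, hQnn]
    have h2 : (81 / 4 : ℚ) * ((t : ℚ) + 11) ^ 2 * (3 * ((t : ℚ) + 9) + 4) * ((t : ℚ) + 12) ^ 2 * ((t : ℚ) + 13) ^ 2
        ≤ (9 / 2 * W) ^ 2 * (((t : ℚ) + 10) * ((t : ℚ) + 12) * ((t : ℚ) + 13)) ^ 2 := by
      have hpos : (0 : ℚ) ≤ ((t : ℚ) + 12) ^ 2 * ((t : ℚ) + 13) ^ 2 := by positivity
      calc (81 / 4 : ℚ) * ((t : ℚ) + 11) ^ 2 * (3 * ((t : ℚ) + 9) + 4) * ((t : ℚ) + 12) ^ 2 * ((t : ℚ) + 13) ^ 2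
          = (81 / 4 : ℚ) * ((3 * ((t : ℚ) + 9) + 4) * ((t : ℚ) + 11) ^ 2) * (((t : ℚ) + 12) ^ 2 * ((t : ℚ) + 13) ^ 2) := by
            ring
        _ ≤ (81 / 4 : ℚ) * (W ^ 2 * ((t : ℚ) + 10) ^ 2) * (((t : ℚ) + 12) ^ 2 * ((t : ℚ) + 13) ^ 2) := by
            gcongr
        _ = (9 / 2 * W) ^ 2 * (((t : ℚ) + 10) * ((t : ℚ) + 12) * ((t : ℚ) + 13)) ^ 2 := by ring
    linarith [h1, h2]
  have hRW : ((42462 : ℚ) + (22557/2 : ℚ) * (t : ℚ) + (1987/2 : ℚ) * (t : ℚ) ^ 2 + (29 : ℚ) * (t : ℚ) ^ 3) / (((t : ℚ) + 10) * ((t : ℚ) + 12) * ((t : ℚ) + 13)) ≤ 9 / 2 * W := by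
    have hb : (0 : ℚ) ≤ 9 / 2 * W := by positivity
    exact (abs_le_of_sq_le_sq' hRsq hb).2
  rw [← hRn] at hRW
  rw [le_div_iff₀ (by positivity)]
  linarith [hRW]

/-! ### §7 The slice `u = 2` of the cell `(q+4, q)` -/

/-- **(R̂) at `m = q − 2` on the cell `(q+4, q)` for every `q ≥ 11`** (`q = m + 2`, `m ≥ 9`): the `j = 3` term is dropped,
`6S₁ + 15S₂` in closed form through the half row, and the Wallis bound on the central binomial closes the linear-in-`4^{m+1}/C`
inequality. -/
theorem rhatCell_four_slice_two (m : ℕ) (hm : 9 ≤ m) :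
    phiK (m + 2 + 4) (m + 2) ≤ rhat (m + 2) 4 m := by
  rw [phiK_four']
  unfold rhat
  rw [sum_Ioo_nat, show (4 : ℕ) - (0 + 1) = 1 + 1 + 1 by rfl, Finset.sum_range_succ _ (1 + 1),
    Finset.sum_range_succ _ 1, Finset.sum_range_one]
  simp only [zero_add, add_zero, show (1 : ℕ) + 1 = 2 by rfl, show (1 : ℕ) + 1 + 1 = 3 by rfl,
    show m + 2 + 4 - m = 6 by omega]
  simp only [Nat.choose_one_right]
  have hm1 : ∀ a, mhat (m + 2) m a 1 = (m + 1 + 1 + 1 + a).choose (a + 1) := fun a => by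
    rw [show m + 2 = m + 1 + 1 by ring]; exact mhat_two m 1 a
  have hm2 : ∀ a, mhat (m + 2) m a 2 = (m + 2 + 2 + a).choose (a + 2) := fun a => by
    have h := mhat_three' m 0 a
    rw [show m + 0 + 2 = m + 2 by ring, show m + 0 + 2 + 2 + a = m + 2 + 2 + a by ring] at h
    exact h
  simp only [hm1, hm2]
  push_cast
  have h3 : (0 : ℚ) ≤ ∑ a ∈ range (m + 1),
      ((m.choose a : ℚ) * ((6 : ℕ).choose 3 : ℚ)) / (mhat (m + 2) m a 3 : ℚ) := by positivity
  have hrw1 : ∑ a ∈ range (m + 1), (m.choose a : ℚ) * 6 / ((m + 1 + 1 + 1 + a).choose (a + 1) : ℚ)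
      = 6 * ∑ a ∈ range (m + 1), (m.choose a : ℚ) / ((m + 1 + 1 + 1 + a).choose (a + 1) : ℚ) := by
    rw [Finset.mul_sum]; exact Finset.sum_congr rfl (fun a _ => by ring)
  have hrw2 : ∑ a ∈ range (m + 1), (m.choose a : ℚ) * ((6 : ℕ).choose 2 : ℚ) / ((m + 2 + 2 + a).choose (a + 2) : ℚ)
      = 15 * ∑ a ∈ range (m + 1), (m.choose a : ℚ) / ((m + 2 + 2 + a).choose (a + 2) : ℚ) := by
    rw [Finset.mul_sum, show (6 : ℕ).choose 2 = 15 by decide]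
    exact Finset.sum_congr rfl (fun a _ => by push_cast; ring)
  rw [hrw1, hrw2, cellTwo_sum_eq m 1, slice_two_S2_eq m (by omega)]
  push_cast
  -- the half row and the Wallis bound
  set C := ((m + 1 + 1 + m).choose m : ℚ) with hC
  set P := ∑ i ∈ range m, ((m + 1 + 1 + m).choose i : ℚ) with hPdef
  have hCpos : (0 : ℚ) < C := by rw [hC]; exact_mod_cast Nat.choose_pos (by omega)
  obtain ⟨r1, r2⟩ := choose_row_two_ratios m
  have hhalf := sum_range_choose_half_two m
  have hP : P = ((4 : ℚ) ^ (m + 1) - C * (3 * m + 4) / (m + 1)) / 2 := by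
    have hB : ((2 * m + 2).choose (m + 1) : ℚ) * (m + 1) = C * (m + 2) := by
      rw [hC, show m + 1 + 1 + m = 2 * m + 2 by ring]; exact_mod_cast r1
    have h2 : ((2 * m + 2).choose (m + 2) : ℚ) = C := by
      rw [hC, show m + 1 + 1 + m = 2 * m + 2 by ring]; exact_mod_cast r2
    have h0 : ((2 * m + 2).choose m : ℚ) = C := by rw [hC, show m + 1 + 1 + m = 2 * m + 2 by ring]
    have hh : ((2 * ∑ i ∈ range m, (2 * m + 2).choose i + (2 * m + 2).choose m + (2 * m + 2).choose (m + 1)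
        + (2 * m + 2).choose (m + 2) : ℕ) : ℚ) = ((4 ^ (m + 1) : ℕ) : ℚ) := by rw [hhalf]
    push_cast at hh
    rw [h0, h2] at hh
    have hPP : P = ∑ i ∈ range m, ((2 * m + 2).choose i : ℚ) := by
      rw [hPdef, show m + 1 + 1 + m = 2 * m + 2 by ring]
    rw [hPP]
    have key : ((4 : ℚ) ^ (m + 1) - C * (3 * m + 4) / (m + 1)) / 2
        = ((4 : ℚ) ^ (m + 1) * (m + 1) - C * (3 * m + 4)) / (2 * (m + 1)) := by
      field_simp
    rw [key, eq_div_iff (by positivity)]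
    linear_combination ((m : ℚ) + 1) * hh - hB
  have hW := centralBinom_sq_mul_le (m + 1) (by omega)
  rw [Nat.centralBinom_eq_two_mul_choose, show 2 * (m + 1) = 2 * m + 2 by ring] at hW
  have hWq : (((2 * m + 2).choose (m + 1) : ℚ)) ^ 2 * (3 * (m + 1) + 1) ≤ ((4 : ℚ) ^ (m + 1)) ^ 2 := by
    have : ((16 : ℕ) : ℚ) ^ (m + 1) = ((4 : ℚ) ^ (m + 1)) ^ 2 := by
      rw [← pow_mul, mul_comm, pow_mul]; norm_num
    have h' : ((((2 * m + 2).choose (m + 1)) ^ 2 * (3 * (m + 1) + 1) : ℕ) : ℚ) ≤ ((16 ^ (m + 1) : ℕ) : ℚ) := by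
      exact_mod_cast hW
    push_cast at h'
    rw [← this]; exact h'
  have h1 : ((2 * m + 2).choose (m + 1) : ℚ) = C * (m + 2) / (m + 1) := by
    rw [eq_div_iff (by positivity), hC, show m + 1 + 1 + m = 2 * m + 2 by ring]; exact_mod_cast r1
  rw [h1] at hWq
  set Y := (4 : ℚ) ^ (m + 1) with hY
  have hYpos : (0 : ℚ) < Y := by positivity
  set W := Y / C with hWdef
  have hWpos : (0 : ℚ) < W := by positivity
  have hYW : Y = W * C := by rw [hWdef]; field_simp
  have hW2 : (3 * (m : ℚ) + 4) * ((m : ℚ) + 2) ^ 2 ≤ W ^ 2 * ((m : ℚ) + 1) ^ 2 := by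
    rw [hYW] at hWq
    have e1 : (3 * (m : ℚ) + 4) * ((m : ℚ) + 2) ^ 2
        = (C * (m + 2) / (m + 1)) ^ 2 * (3 * ((m : ℚ) + 1) + 1) * (((m : ℚ) + 1) ^ 2 / C ^ 2) := by
      field_simp; ring
    have e2 : W ^ 2 * ((m : ℚ) + 1) ^ 2 = (W * C) ^ 2 * (((m : ℚ) + 1) ^ 2 / C ^ 2) := by
      field_simp
    rw [e1, e2]
    exact mul_le_mul_of_nonneg_right hWq (by positivity)
  rw [hP, hYW, sliceTwo_linear m C W hCpos]
  obtain ⟨t, rfl⟩ : ∃ t, m = t + 9 := ⟨m - 9, by omega⟩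
  push_cast at hW2 ⊢
  have hfin := sliceTwo_finish t W hWpos hW2
  linarith [hfin, h3]

/-- The slice `u = 2` of the cell `(q+4, q)` for every `q ≥ 11`, in the `q − 2` spelling. -/
theorem rhatCell_four_pred_pred (q : ℕ) (hq : 11 ≤ q) : phiK (q + 4) q ≤ rhat q 4 (q - 2) := by
  obtain ⟨m, rfl⟩ : ∃ m, q = m + 2 := ⟨q - 2, by omega⟩
  rw [show m + 2 - 2 = m by omega]
  exact rhatCell_four_slice_two m (by omega)

/-- **The slice `u = 2` of the cell `(q+4, q)` for EVERY `q ≥ 2`**: `q ≤ 10` from the kernel cells of gen 14 (`rhatCell_q_4`,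
`q = 4 … 10`) and the ends (`q = 2`: `m = 0`, `rhat_zero_eq`; `q = 3`: `m = 1`, `rhatCell_one`), `q ≥ 11` from
`rhatCell_four_pred_pred`. -/
theorem rhat_four_slice_two_all (q : ℕ) (hq : 2 ≤ q) : phiK (q + 4) q ≤ rhat q 4 (q - 2) := by
  rcases Nat.lt_or_ge q 11 with hlt | hge
  · interval_cases q
    · rw [rhat_zero_eq 2 4 (by norm_num)]
    · exact rhatCell_one 3 4 (by norm_num) (by norm_num)
    · exact rhatCell_4_4 2 (by norm_num)
    · exact rhatCell_5_4 3 (by norm_num)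
    · exact rhatCell_6_4 4 (by norm_num)
    · exact rhatCell_7_4 5 (by norm_num)
    · exact rhatCell_8_4 6 (by norm_num)
    · exact rhatCell_9_4 7 (by norm_num)
    · exact rhatCell_10_4 8 (by norm_num)
  · exact rhatCell_four_pred_pred q hge

end PercRepro
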